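import Literature.AnabelianGeometry.EtaleTheta.SettingModelMuTwo
import Literature.AnabelianGeometry.EtaleTheta.GalSectThm110iii
import Literature.AnabelianGeometry.EtaleTheta.GalSectIntegralStructures
import HarnessLib

/-!
# The CUSP-indexed [EtTh] §1 records are EMPTY at the root models (kernel certificate; NV-L2 census v2)

S. Mochizuki, *The étale theta function …* [EtTh], Publ. RIMS **45** (2009), §1 pp.11–13, Prop. 1.4 (iii)
p.22, Thm. 1.10 (iii) p.30 [cite: MochizukiEtTh2009, §1 p.12]; S. Mochizuki, *Galois sections in absolute
anabelian geometry* [GalSect], Nagoya Math. J. **179** (2005), §4 p.33 [cite: MochizukiGalSect2005, §4 p.33].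

abc-iut cell, layer L2, NV programme (§4(iii); abc-iut-L2-lead RULINGS #5 R45, census holder
abc-iut-w5-d029; INHABITATION-CENSUS-L2-v2.md).  abc-iut-L2-t1's root model `ThetaSetting.model p`
(`SettingModel.lean`, p421399) and its extension `MuTwoSetting.model p` (`SettingModelMuTwo.lean`) are
built on the tempered-curve layer `SettingModel.curve p` whose type of closed points is `PEmpty` ("no
closed points (the decomposition-group clauses hold vacuously)", `SettingModelCurve.lean`).  Consequently
every interface record that CARRIES A CUSP of `X` as a field is uninhabited over these models — a second,
independent source of vacuity next to abc-iut-w5-d171's `ThetaSetting.model_isEmpty_kummerData`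
(p424679: the `E : KummerData`-indexed block).  PROOF-ONLY (0 definitions):

* (the once-punctured parameter bundle `OncePuncturedData`, clause (P2) "`X^log` has a cusp", is the
  same phenomenon — certified separately by its author abc-iut-L2-t7, p425645
  `ThetaSetting.model_isEmpty_oncePuncturedData`; not restated here);
* `MuTwoSetting.model_isEmpty_dotCCusp`, `MuTwoSetting.model_isEmpty_dotCCuspTorsor` — the data of the
  cusp of `Ċ` (Thm. 1.10 (iii); fields `cusp : M.Pt`, `cusp_isCusp`) are empty at `MuTwoSetting.model p`
  for every `ε ∈ Π^tp_C`;
* `ThetaSetting.model_isEmpty_cuspidalPointDd` — the cusps of `Ÿ` (Prop. 1.4 (iii) data) are empty at the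
  root for every `E` (independently of p424679);
* `SettingModel.curve_isEmpty_pt`, `GalSect.model_splittingClass_forall` — bookkeeping: no point, hence
  the [GalSect] §4 torsor records at the model curve quantify over no cusp at all.

CENSUS CONSEQUENCE (for the χ-twisted root model under design, L2-lead R78/R85): to un-vacate the
cusp-indexed block (OncePuncturedData, DotCCusp, DotCCuspTorsor, CuspidalPointDd, CuspidalTorsorData /
Cor28iiData at the model) a model must ALSO carry a closed point `x` with `IsCusp x` and the printed
decomposition/inertia clauses of the L3 interface (`decomp`, `inertia_eq_bot`, `inertia_equiv_zHat`),
not only a non-trivial cyclotomic action on `Δ_Θ`.  HONEST FRAMING: a statement about the TYPED models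
(consistency witnesses), nothing about a Tate curve; [EtTh]/[GalSect] are refereed; typed ≠ proved; no side
taken on [IUTchIII] Cor. 3.12.
-/

namespace Literature.AnabelianGeometry.EtaleTheta

variable (p : ℕ) [Fact p.Prime]

/-- The model curve has no closed point: `(curve p).Pt = PEmpty`. [cite: MochizukiEtTh2009, §1 p.11] -/
theorem SettingModel.curve_isEmpty_pt : IsEmpty (SettingModel.curve p).Pt :=
  inferInstanceAs (IsEmpty PEmpty)

/-- Hence the root model `ThetaSetting.model p` has no closed point. [cite: MochizukiEtTh2009, §1 p.11] -/
theorem ThetaSetting.model_isEmpty_pt : IsEmpty (ThetaSetting.model p).Pt :=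
  inferInstanceAs (IsEmpty PEmpty)

/-- … and neither has `MuTwoSetting.model p`. [cite: MochizukiEtTh2009, Def 1.7 p.27] -/
theorem MuTwoSetting.model_isEmpty_pt : IsEmpty (MuTwoSetting.model p).Pt :=
  inferInstanceAs (IsEmpty PEmpty)

/-- **The data of the cusp of `Ċ` (Thm. 1.10 (iii)) are EMPTY at `MuTwoSetting.model p`** for every
`ε ∈ Π^tp_C`: the field `cusp : M.Pt` has no value. [cite: MochizukiEtTh2009, Thm 1.10 (iii) p.30] -/
theorem MuTwoSetting.model_isEmpty_dotCCusp (εZ : (MuTwoSetting.model p).GtpC) :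
    IsEmpty ((MuTwoSetting.model p).DotCCusp εZ) :=
  ⟨fun C => PEmpty.elim C.cusp⟩

/-- **The torsor data of the cusp of `Ċ` are EMPTY at `MuTwoSetting.model p`** for every `ε ∈ Π^tp_C`
(same field `cusp : M.Pt`). [cite: MochizukiEtTh2009, Thm 1.10 (iii) p.30] -/
theorem MuTwoSetting.model_isEmpty_dotCCuspTorsor (εZ : (MuTwoSetting.model p).GtpC) :
    IsEmpty ((MuTwoSetting.model p).DotCCuspTorsor εZ) :=
  ⟨fun C => PEmpty.elim C.cusp⟩

/-- **The cusps of `Ÿ` (Prop. 1.4 (iii) data `CuspidalPointDd`) are EMPTY at the root model** for every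
Kummer datum `E` — independently of the emptiness of `KummerData` itself (p424679): the field
`cusp : D.Pt` has no value. [cite: MochizukiEtTh2009, Prop 1.4 (iii) p.22] -/
theorem ThetaSetting.model_isEmpty_cuspidalPointDd (E : (ThetaSetting.model p).KummerData) :
    IsEmpty ((ThetaSetting.model p).CuspidalPointDd E) :=
  ⟨fun C => PEmpty.elim C.cusp⟩

/-- Bookkeeping for the [GalSect] §4 records at the model curve: every statement quantified over a
closed point `x : (curve p).Pt` (e.g. `∀ x, Nonempty (GalSect.CuspidalTorsorData (curve p) x)`) holds
vacuously — there is no cusp to carry a torsor. [cite: MochizukiGalSect2005, §4 p.33] -/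
theorem GalSect.model_forall_pt (P : (SettingModel.curve p).Pt → Prop) :
    ∀ x : (SettingModel.curve p).Pt, P x :=
  fun x => PEmpty.elim x

/-- In particular `CuspidalTorsorData` is (vacuously) inhabited at every point of the model curve, and
(equally vacuously) empty at every point — the honest reading is "no cusp at the model".
[cite: MochizukiGalSect2005, §4 p.33] -/
theorem GalSect.model_cuspidalTorsorData_forall :
    ∀ x : (SettingModel.curve p).Pt, Nonempty (GalSect.CuspidalTorsorData (SettingModel.curve p) x) ∧
      IsEmpty (GalSect.CuspidalTorsorData (SettingModel.curve p) x) :=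
  fun x => PEmpty.elim x

end Literature.AnabelianGeometry.EtaleTheta
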